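import Literature.Probability.Percolation.KestenScalingThetaFromAltSeparation
import Literature.Probability.Percolation.AltFourArmStability
import HarnessLib

/-!
# `θ(p) ≍ π₁(L_ε(p))` from TWO alternating displays: separation and the a priori bound (assembly, proofs only)

Topic `Literature/Probability/Percolation`; family `crit-perc`, statement **crit-perc.S16**.
PROOFS ONLY (no definition, no named fact). Eighth proof file of the named fact
`Literature.Probability.Percolation.Nolin2008_theta_asymp` (`KestenScaling.lean`; P. Nolin,
*Near-critical percolation in two dimensions*, EJP 13 (2008), §7.4, eq. (7.25) with Cor. 41
[arXiv 0711.4948: Cor. 39 and the display following it]: for `p > 1/2`,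
`θ(p) ≍ P_p(0 ↔ ∂S_{L(p)}) ≍ P_{1/2}(0 ↔ ∂S_{L(p)}) = π₁(L(p))`, for every fixed `ε ∈ (0, 1/2)`),
after `KestenScalingThetaFromAltSeparation.lean`.

## What this file records

`KestenScalingThetaFromAltSeparation.lean` proves `Nolin2008_theta_asymp` from Werner's one-arm
stability `Werner2009_oneArm_nearCritical` and THREE displayed statements about Werner's
alternating four-arm probability `π̂^alt = altFourArmProbAt` below `L(p)`:

* `(hsepA)` near-critical separation of four alternating arms,
  `c · π̂^alt_t(n, N) ≤ P_t(sepFourArm n N)` for `n₀ ≤ n`, `2n ≤ N ≤ L(t, ε)`, `t ∈ [1/2, 1/2 + δ)`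
  (Nolin 2008, Thm. 11 for `j = 4`, `σ = BWBW` [arXiv Thm. 10]; Werner 2009, Prop. 6.1; Kesten
  1987, Lemmas 4–6);
* `(hLB)` the a priori lower bound `c (m/n)^{2-β} ≤ π̂^alt_t(m, n)` below `L(p)` (Werner 2009,
  Lecture 6, §3, third estimate; Nolin 2008, Thm. 24 (ii) [arXiv Thm. 23]);
* `(hS)` Werner's Lemma 6.3 for `π̂^alt`, `c π̂^alt_{1/2}(r₀, N) ≤ π̂^alt_t(r₀, N) ≤ C π̂^alt_{1/2}(r₀, N)`
  below `L(t, ε)` (Nolin 2008, Thm. 27 for `j = 4`, `σ = BWBW` [arXiv Thm. 26]).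

Two of these four inputs are meanwhile CONSEQUENCES of `(hsepA)` and `(hLB)` in the tree:

* `(hS)` is `altFourArm_stability_of_altSeparation hsepA hLB` (`AltFourArmStability.lean`: Werner's
  §5 differential inequality for the landed alternating event, `landedPivotalSum_le`, integrated by
  `real_ratio_le_exp_of_pivotal_bound`);
* the one-arm stability is `Werner2009_oneArm_nearCritical_of_altHyps`
  (`NearCriticalOneArmFromAltFacts.lean`) fed with the quasi-multiplicativity of `π̂^alt`
  (`altFourArm_quasiMult_of_altSeparation hsepA`, `AltFourArmGlue.lean`), `(hLB)`, and the interior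
  pivotal lower bound with the alternating kernel (`pivotal_lowerBound_of_separation_gen` at
  `X = π̂^alt`, `AltPivotalLowerBound.lean`, from `(hsepA)`); equivalently
  `Werner2009_oneArm_nearCritical_of_altSeparation hsepA hLB`
  (`WernerOneArmStabilityFromAltSeparation.lean`).

Hence — this file — **`Nolin2008_theta_asymp` (and `Nolin2008_cor41`, and Kesten's relation with
the critical alternating kernel) from the TWO displays `(hsepA)`, `(hLB)`**:

* `altKestenBounds_of_altSeparation_of_altLB` — `|p - 1/2| L_ε(p)² π̂^alt_{1/2}(r₀, L_ε(p)) ≤ C`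
  (`ε < 1/2`) and `≥ c(ε) > 0` (every `ε ∈ (0, 1/2)`) for `p ≠ 1/2` near `1/2` (Kesten 1987, (4.5)
  with (1.12); Nolin 2008, Prop. 34 for `σ = BWBW`; Werner 2009, Cor. 6.3 and the display after
  Lemma 6.3) — `kestenBounds_alt_of_altRhombusPivotal` with `altRhombusPivotal_of_altSeparation`;
* `Nolin2008_cor41_of_altSeparation_of_altLB` — Cor. 41 at every `ε ∈ (0, 1/2)`;
* `Nolin2008_theta_asymp_of_altSeparation_of_altLB` — the named fact.

The discharge `Nolin2008_theta_asymp_holds` is `Nolin2008_theta_asymp_of_altSeparation_of_altLB`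
applied to Nolin's arm-separation Thm. 11 for `j = 4`, `σ = BWBW` below `L(p)` (the port of the
tree's `ArmSeparation*.lean` programme to general `p`, `ArmSeparation*At.lean`) and to the
alternating five-arm a priori bound (`FiveArm*.lean`, `CentralFiveArm*.lean`) once both are
theorems. Everything here is proved; no `sorry`, no new definition, no new named fact (D-0026).

## References

* P. Nolin, Near-critical percolation in two dimensions, *Electron. J. Probab.* 13 (2008)
  1562–1623: §4.3 Thm. 11, §5.2 Thm. 24, §6.1 Thm. 27, §7.3 Prop. 34, Remark 35, Cor. 37, §7.4
  Cor. 41, eq. (7.25) (arXiv 0711.4948: Thm. 10, Thm. 23, Thm. 26, Prop. 32, Remark 34, Cor. 35,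
  Cor. 39) [Nolin2008].
* W. Werner, *Lectures on two-dimensional critical percolation*, IAS/Park City Math. Ser. 16
  (2009), Lecture 6, §3, Prop. 6.1, Cor. 6.2, Lemma 6.2, Cor. 6.3, Lemma 6.3, §5
  (arXiv 0710.0856, pp. 43–48) [WernerPCMI2009].
* H. Kesten, Scaling relations for 2D-percolation, *Comm. Math. Phys.* 109 (1987) 109–156,
  (1.12), Lemmas 4–6, Lemma 8, (4.5), Thms. 1–2 [KestenScalingCMP1987].

Tree: `Nolin2008_theta_asymp_of_oneArm_of_altSeparation`, `Nolin2008_cor41_of_altSeparation`,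
`kestenBounds_alt_of_altRhombusPivotal`, `altRhombusPivotal_of_altSeparation`
(`KestenScalingThetaFromAltSeparation.lean`), `altFourArm_stability_of_altSeparation`
(`AltFourArmStability.lean`), `Werner2009_oneArm_nearCritical_of_altHyps`
(`NearCriticalOneArmFromAltFacts.lean`), `altFourArm_quasiMult_of_altSeparation`
(`AltFourArmGlue.lean`), `pivotal_lowerBound_of_separation_gen` (`AltPivotalLowerBound.lean`),
`altFourArmProbAt_anti` (`AltFourArm.lean`).
-/

noncomputable section

open MeasureTheory Set
open scoped unitInterval

namespace Literature.Probability.Percolation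

open LatticeModels

/-- **Kesten's scaling relation with the critical ALTERNATING four-arm kernel from the two displays
`(hsepA)`, `(hLB)`** (Kesten 1987, (4.5) with the alternating event (1.12); Nolin 2008, §7.3,
Prop. 34 [arXiv 0711.4948: Prop. 32] for `σ = BWBW` and Remark 35; Werner 2009, Lecture 6, Cor. 6.3
and the display following Lemma 6.3, `π̂_p` being Werner's alternating four-arm probability):
(i) `|p - 1/2| · L_ε(p)² · π̂^alt_{1/2}(r₀, L_ε(p)) ≤ C` for every `ε < 1/2`, `p ≠ 1/2` near `1/2`,
`r₀` large, and (ii) `c(ε) ≤ |p - 1/2| · L_ε(p)² · π̂^alt_{1/2}(r₀, L_ε(p))` with `c(ε) > 0` for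
every `ε ∈ (0, 1/2)` — `kestenBounds_alt_of_altRhombusPivotal` on the pivotal count
`altRhombusPivotal_of_altSeparation hsepA hLB hS`, the stability `hS` being
`altFourArm_stability_of_altSeparation hsepA hLB`. [cite: KestenScalingCMP1987, (1.12), (4.5)] [cite: Nolin2008, §7.3, Prop. 34 and Remark 35 (arXiv 0711.4948: Prop. 32, Remark 34)] [cite: WernerPCMI2009, Lecture 6, Cor. 6.3, Lemma 6.3 and the display following it] -/
theorem altKestenBounds_of_altSeparation_of_altLB
    (hsepA : ∃ ε₁ > (0 : ℝ), ∀ ⦃ε : ℝ⦄, 0 < ε → ε < ε₁ →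
      ∃ n₀ : ℕ, ∃ δ > (0 : ℝ), ∃ c > (0 : ℝ),
        ∀ t : unitInterval, 1 / 2 ≤ (t : ℝ) → (t : ℝ) < 1 / 2 + δ →
          ∀ n N : ℕ, n₀ ≤ n → 2 * n ≤ N → (1 / 2 < (t : ℝ) → N ≤ charLengthW ε t) →
            c * altFourArmProbAt t n N ≤ (triSitePercolation t).real (sepFourArm n N))
    (hLB : ∃ ε₁ > (0 : ℝ), ∀ ⦃ε : ℝ⦄, 0 < ε → ε < ε₁ →
      ∃ r₁ : ℕ, ∃ δ > (0 : ℝ), ∃ β > (0 : ℝ), ∃ c > (0 : ℝ),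
        ∀ t : unitInterval, 1 / 2 ≤ (t : ℝ) → (t : ℝ) < 1 / 2 + δ →
          ∀ m n : ℕ, r₁ ≤ m → m ≤ n → (1 / 2 < (t : ℝ) → n ≤ charLengthW ε t) →
            c * ((m : ℝ) / n) ^ (2 - β) ≤ altFourArmProbAt t m n) :
    (∃ ε₁ > (0 : ℝ), ∀ ⦃ε : ℝ⦄, 0 < ε → ε < ε₁ → ∃ r₁ : ℕ, ∀ r₀ ≥ r₁, ∃ δ > (0 : ℝ),
      ∃ C : ℝ, ∀ p : unitInterval, (p : ℝ) ≠ 1 / 2 → |(p : ℝ) - 1 / 2| < δ →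
        |(p : ℝ) - 1 / 2| * (charLength ε p : ℝ) ^ 2 * altFourArmProbAt half r₀ (charLength ε p) ≤ C) ∧
    (∀ ⦃ε : ℝ⦄, 0 < ε → ε < 1 / 2 → ∃ r₁ : ℕ, ∀ r₀ ≥ r₁, ∃ δ > (0 : ℝ), ∃ c > (0 : ℝ),
      ∀ p : unitInterval, (p : ℝ) ≠ 1 / 2 → |(p : ℝ) - 1 / 2| < δ →
        c ≤ |(p : ℝ) - 1 / 2| * (charLength ε p : ℝ) ^ 2 * altFourArmProbAt half r₀ (charLength ε p)) :=
  kestenBounds_alt_of_altRhombusPivotal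
    (altRhombusPivotal_of_altSeparation hsepA hLB (altFourArm_stability_of_altSeparation hsepA hLB))

/-- **Nolin's Cor. 41 at every `ε ∈ (0, 1/2)` from the two displays `(hsepA)`, `(hLB)`** (Nolin
2008, §7.4, Cor. 41 [arXiv 0711.4948: Cor. 39]: `P_p(0 ↔ ∂S_{L_ε(p)}) ≍ π₁(L_ε(p))`, through the
equivalence of lengths Cor. 37 and Kesten's relation Prop. 34): `Nolin2008_cor41_of_altSeparation`
with the stability of `π̂^alt` supplied by `altFourArm_stability_of_altSeparation hsepA hLB`. [cite: Nolin2008, §7.4 Cor. 41, §7.3 Cor. 37 and Prop. 34, Thm. 27 (arXiv 0711.4948: Cor. 39, Cor. 35, Prop. 32, Thm. 26)] [cite: WernerPCMI2009, Lecture 6, Lemma 6.3] -/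
theorem Nolin2008_cor41_of_altSeparation_of_altLB
    (hsepA : ∃ ε₁ > (0 : ℝ), ∀ ⦃ε : ℝ⦄, 0 < ε → ε < ε₁ →
      ∃ n₀ : ℕ, ∃ δ > (0 : ℝ), ∃ c > (0 : ℝ),
        ∀ t : unitInterval, 1 / 2 ≤ (t : ℝ) → (t : ℝ) < 1 / 2 + δ →
          ∀ n N : ℕ, n₀ ≤ n → 2 * n ≤ N → (1 / 2 < (t : ℝ) → N ≤ charLengthW ε t) →
            c * altFourArmProbAt t n N ≤ (triSitePercolation t).real (sepFourArm n N))
    (hLB : ∃ ε₁ > (0 : ℝ), ∀ ⦃ε : ℝ⦄, 0 < ε → ε < ε₁ →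
      ∃ r₁ : ℕ, ∃ δ > (0 : ℝ), ∃ β > (0 : ℝ), ∃ c > (0 : ℝ),
        ∀ t : unitInterval, 1 / 2 ≤ (t : ℝ) → (t : ℝ) < 1 / 2 + δ →
          ∀ m n : ℕ, r₁ ≤ m → m ≤ n → (1 / 2 < (t : ℝ) → n ≤ charLengthW ε t) →
            c * ((m : ℝ) / n) ^ (2 - β) ≤ altFourArmProbAt t m n) :
    Nolin2008_cor41 :=
  Nolin2008_cor41_of_altSeparation hsepA hLB (altFourArm_stability_of_altSeparation hsepA hLB)

/-- **`θ(p) ≍ π₁(L_ε(p))` for every `ε ∈ (0, 1/2)` (`Nolin2008_theta_asymp`) from the two displays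
`(hsepA)`, `(hLB)`** (Nolin 2008, §7.4, eq. (7.25) [arXiv 0711.4948: the display following Cor. 39]
with Cor. 41 and Thm. 27; Kesten 1987, Thm. 2; Werner 2009, Lecture 6, §5, "End of the proof of the
theorem"): IF `(hsepA)` `c · π̂^alt_t(n, N) ≤ P_t(sepFourArm n N)` uniformly below `L(t, ε)` (Nolin's
Thm. 11 for `j = 4`, `σ = BWBW`; Werner's Prop. 6.1; Kesten's Lemmas 4–6) AND `(hLB)`
`c (m/n)^{2-β} ≤ π̂^alt_t(m, n)` below `L(p)` (Werner, §3, third estimate; Nolin's Thm. 24 (ii)),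
THEN `Nolin2008_theta_asymp`: `Nolin2008_theta_asymp_of_oneArm_of_altSeparation` with the one-arm
stability `Werner2009_oneArm_nearCritical_of_altHyps` (its quasi-multiplicativity input
`altFourArm_quasiMult_of_altSeparation hsepA`, its interior pivotal lower bound
`pivotal_lowerBound_of_separation_gen` at the kernel `π̂^alt`) and the stability
`altFourArm_stability_of_altSeparation hsepA hLB`. The discharge `Nolin2008_theta_asymp_holds` is
this theorem applied to the two displays once they are theorems of the tree. [cite: Nolin2008, §7.4, eq. (7.25) and Cor. 41; §6.1 Thm. 27; §4.3 Thm. 11; §5.2 Thm. 24 (arXiv 0711.4948: Cor. 39, Thm. 26, Thm. 10, Thm. 23)] [cite: KestenScalingCMP1987, Thm. 2] [cite: WernerPCMI2009, Lecture 6, Prop. 6.1, §3, Lemma 6.3, §5] -/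
theorem Nolin2008_theta_asymp_of_altSeparation_of_altLB
    (hsepA : ∃ ε₁ > (0 : ℝ), ∀ ⦃ε : ℝ⦄, 0 < ε → ε < ε₁ →
      ∃ n₀ : ℕ, ∃ δ > (0 : ℝ), ∃ c > (0 : ℝ),
        ∀ t : unitInterval, 1 / 2 ≤ (t : ℝ) → (t : ℝ) < 1 / 2 + δ →
          ∀ n N : ℕ, n₀ ≤ n → 2 * n ≤ N → (1 / 2 < (t : ℝ) → N ≤ charLengthW ε t) →
            c * altFourArmProbAt t n N ≤ (triSitePercolation t).real (sepFourArm n N))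
    (hLB : ∃ ε₁ > (0 : ℝ), ∀ ⦃ε : ℝ⦄, 0 < ε → ε < ε₁ →
      ∃ r₁ : ℕ, ∃ δ > (0 : ℝ), ∃ β > (0 : ℝ), ∃ c > (0 : ℝ),
        ∀ t : unitInterval, 1 / 2 ≤ (t : ℝ) → (t : ℝ) < 1 / 2 + δ →
          ∀ m n : ℕ, r₁ ≤ m → m ≤ n → (1 / 2 < (t : ℝ) → n ≤ charLengthW ε t) →
            c * ((m : ℝ) / n) ^ (2 - β) ≤ altFourArmProbAt t m n) :
    Nolin2008_theta_asymp :=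
  Nolin2008_theta_asymp_of_oneArm_of_altSeparation
    (Werner2009_oneArm_nearCritical_of_altHyps (altFourArm_quasiMult_of_altSeparation hsepA) hLB
      (pivotal_lowerBound_of_separation_gen (X := fun t r R => altFourArmProbAt t r R)
        (fun t r _ _ h h' => altFourArmProbAt_anti t r h h') hsepA))
    hsepA hLB (altFourArm_stability_of_altSeparation hsepA hLB)

end Literature.Probability.Percolation

end
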